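import Summits.QuantumFields.YangMills.Theorems.BalabanLadderUVSeamRecUnitTransferPrep
import HarnessLib

/-!
# Crux `UVSeamRec` (stmt-QuantumFields-20043), stub `stub_floors`: unit transfer of the floors — II, two-point

Helper file (`--supports stmt-QuantumFields-20043`), part II of the series `BalabanLadderUVSeamRecUnitTransfer*`.

WHAT THE PINNED UNIT COSTS (the series `BalabanLadderUVSeamRecUnitTransfer*`).  The registered stub `stub_floors` of
crux `UVSeamRec` (stmt-QuantumFields-20043) asks for the non-triviality floors `LowerBounds SU(2) r uRec` at the
two-loop unit of record `uRec`.  Any engine (the NT line's femto package through the landed `stub_lower`, or Track A's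
N32′) delivers floors at ITS OWN unit `a`, with COMPACTLY SUPPORTED bump witnesses (all `stub_lower` ever produces).
The series proves that such floors move to any unit `u` with `a β / u β → c₀ ∈ (0, ∞)` (asymptotic two-loop scaling of
the engine's unit up to a constant) PROVIDED the density ceilings `MomentBounds G r u` (a fortiori the plane-resolved
`MomentBounds6 G r u` of the ceilings stub) hold at the target unit; mere two-sided comparability `c ≤ a/u ≤ C` does
not suffice by this argument (a floor for one witness does not control its dilates).

This file: `twoPoint_transfer` — at ratio one (`a/u → 1`) the reflection-paired floor `ε ≤ Q2(θv, v)` at unit `a`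
for a compactly supported positive-time bump `v` yields `ε/2 ≤ Q2(θv, v)` at unit `u` for the SAME witness, given the
density ceilings at `u`.  Mechanism: the two smeared sums differ by `Σ [w(u·x) − w(a·x)] · Cov(x)`; every
contributing pair sits at lattice time-separation `≥ δ/u(β)` inside a ball of radius `2M/u(β)`, so the collar
bound `(C/R⁴)²` with `R ≍ 1/u(β)` and the count `≍ u(β)⁻⁸` cancel exactly (hyperscaling) while the weight difference
is `o(1)` by uniform continuity.
-/

set_option autoImplicit false

noncomputable section

open scoped SchwartzMap BigOperators
open MeasureTheory Filter Topology Metric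
open Literature.MathematicalPhysics.QuantumFieldTheory Literature.MathematicalPhysics.QuantumLattice
open Literature.Probability.LatticeModels (box Site mem_box card_box)
open Summit.QuantumFields.YangMills.Cruxes.OSLegsFromFemtoAndGap.DlrCollarTransfer
open Summit.QuantumFields.YangMills.Theorems.OSLegsFromFemtoAndGap

namespace Summit.QuantumFields.YangMills.Cruxes.UVSeamRec.UnitTransfer

variable {G : Type} [Group G] [TopologicalSpace G] [IsTopologicalGroup G] [CompactSpace G]
  [MeasurableSpace G] [BorelSpace G]

/-! ### The two-point transfer at ratio one -/

/-- **Two-point floor transfer at ratio one.**  Floors `ε ≤ Q2(θv, v)` at unit `a` for a compactly supported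
positive-time bump `v`, density ceilings at unit `u`, `u → 0⁺` and `a/u → 1` give the floor `ε/2 ≤ Q2(θv, v)` at unit `u`
for the SAME witness, on every large torus at every large coupling. [folklore] -/
theorem twoPoint_transfer (r : LatticeRep G) {a u : ℝ → ℝ} (ha : ∀ β, 0 < a β) (hu : ∀ β, 0 < u β)
    (hu0 : Tendsto u atTop (𝓝 0)) (hau : Tendsto (fun β => a β / u β) atTop (𝓝 1))
    (hMB : MomentBounds G r u) (v : 𝓢(EuclideanSpace ℝ (Fin 4), ℝ))
    (hvK : HasCompactSupport (v : EuclideanSpace ℝ (Fin 4) → ℝ))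
    (hvpos : tsupport (v : EuclideanSpace ℝ (Fin 4) → ℝ) ⊆ {y : EuclideanSpace ℝ (Fin 4) | 0 < y 0})
    {ε β₅ Λ₅ : ℝ} (hε : 0 < ε)
    (hfloor : ∀ β : ℝ, β₅ ≤ β → ∀ L : ℕ, Λ₅ ≤ a β * L → ε ≤ Q2 G r β L (a β) (thetaTest 4 v) v) :
    ∃ β₅' Λ₅' : ℝ, ∀ β : ℝ, β₅' ≤ β → ∀ L : ℕ, Λ₅' ≤ u β * L →
      ε / 2 ≤ Q2 G r β L (u β) (thetaTest 4 v) v := by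
  classical
  -- support data of the bump
  obtain ⟨δ, M, hδ, hM, hsupp⟩ := exists_time_floor_and_radius hvK hvpos
  have hM0 : 0 < M := by linarith
  -- sup bound of the bump
  set B : ℝ := SchwartzMap.seminorm ℝ 0 0 v with hB
  have hBv : ∀ z, |v z| ≤ B := fun z => by
    have h := SchwartzMap.norm_le_seminorm ℝ v z
    rwa [Real.norm_eq_abs] at h
  have hB0 : 0 ≤ B := (abs_nonneg _).trans (hBv 0)
  -- the ceilings
  obtain ⟨C, β₄, ℓ₄, hℓ₄, hC, H⟩ := abs_torusMoment_le_of_momentBounds r hMB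
  -- constants
  set ρ : ℝ := min (δ / 4) ℓ₄ with hρdef
  have hρ : 0 < ρ := lt_min (by positivity) hℓ₄
  have hρδ : ρ ≤ δ / 4 := min_le_left _ _
  have hρℓ : ρ ≤ ℓ₄ := min_le_right _ _
  clear_value ρ B
  set K₀ : ℝ := (14 * M / ρ) ^ 8 * (2 * B * C ^ 2) with hK₀
  have hK₀0 : 0 ≤ K₀ := by positivity
  set η : ℝ := ε / (2 * (K₀ + 1)) with hη
  have hη0 : 0 < η := by positivity
  have hKη : K₀ * η ≤ ε / 2 := by
    rw [hη, mul_div_assoc', div_le_div_iff₀ (by positivity) (by positivity)]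
    nlinarith [hK₀0, hε]
  clear_value K₀ η
  -- modulus of continuity of the bump
  obtain ⟨θ₀, hθ₀, hmod⟩ := exists_modulus v hvK hη0
  -- eventual scale bookkeeping
  obtain ⟨β₀, hβ₀⟩ := eventually_scales hu hu0 hau β₄ β₅ hM hθ₀ hδ hρ
  refine ⟨β₀, max (2 * Λ₅) (max (4 * M) (4 * ρ + 8)), fun β hβ L hL => ?_⟩
  obtain ⟨hβ₄, hβ₅, halo, hahi, hu1, hθ, huδ, huρ⟩ := hβ₀ β hβ
  have huβ := hu β
  have haβ := ha β
  have hL1 : 2 * Λ₅ ≤ u β * L := (le_max_left _ _).trans hL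
  have hL2 : 4 * M ≤ u β * L := ((le_max_left _ _).trans (le_max_right _ _)).trans hL
  have hL3 : 4 * ρ + 8 ≤ u β * L := ((le_max_right _ _).trans (le_max_right _ _)).trans hL
  have hLpos : (0 : ℝ) ≤ L := Nat.cast_nonneg L
  -- the floor at unit `a` applies on this torus
  have hfl : ε ≤ Q2 G r β L (a β) (thetaTest 4 v) v := by
    refine hfloor β hβ₅ L ?_
    have h' : u β / 2 * L ≤ a β * L := mul_le_mul_of_nonneg_right halo hLpos
    linarith
  -- the collar radius
  obtain ⟨hR1, hRu, hRlo⟩ := collar_radius hρ huβ huρ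
  set R : ℕ := ⌊ρ / u β⌋₊ with hRdef
  clear_value R
  have hRpos : (0 : ℝ) < R := by exact_mod_cast hR1
  have hRℓ : (R : ℝ) * u β ≤ ℓ₄ := hRu.trans hρℓ
  have hRL : 4 * R + 8 ≤ L := by
    have h' : (4 * (R : ℝ) + 8) * u β ≤ (L : ℝ) * u β := by
      have e1 : (4 * (R : ℝ) + 8) * u β = 4 * ((R : ℝ) * u β) + 8 * u β := by ring
      have e2 : (L : ℝ) * u β = u β * L := mul_comm _ _
      rw [e1, e2]
      linarith [hRu, hL3, hu1, huβ]
    have h'' : (4 * (R : ℝ) + 8) ≤ (L : ℝ) := le_of_mul_le_mul_right h' huβ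
    exact_mod_cast h''
  have hsepR : 2 * (R : ℝ) + 4 ≤ δ / u β := by
    have h1 : (R : ℝ) ≤ ρ / u β := by rw [le_div_iff₀ huβ]; exact hRu
    have h2 : ρ / u β ≤ δ / 4 / u β := div_le_div_of_nonneg_right hρδ huβ.le
    have h3 : 4 ≤ δ / 2 / u β := by rw [le_div_iff₀ huβ]; linarith
    have h4 : δ / u β = δ / 4 / u β + δ / 4 / u β + δ / 2 / u β := by ring
    linarith
  -- the pointwise ceiling `(C/R⁴)² ≤ C² (2u/ρ)⁸`
  have hw : (C / (R : ℝ) ^ 4) ^ 2 ≤ C ^ 2 * (2 * u β / ρ) ^ 8 := by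
    have hinv : 1 / (R : ℝ) ≤ 2 * u β / ρ := by
      rw [div_le_div_iff₀ hRpos hρ]
      have h := hRlo
      rw [div_le_iff₀ (by positivity)] at h
      linarith
    have h0 : 0 ≤ 1 / (R : ℝ) := by positivity
    calc (C / (R : ℝ) ^ 4) ^ 2 = C ^ 2 * (1 / R) ^ 8 := by ring
      _ ≤ C ^ 2 * (2 * u β / ρ) ^ 8 := by gcongr
  have hw0 : 0 ≤ C ^ 2 * (2 * u β / ρ) ^ 8 := by positivity
  -- the ceilings at `(β, L, R)`
  have Hβ : ∀ (n : ℕ) (x : Fin n → Site 4),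
      (∀ i j : Fin n, i ≠ j → ∃ k : Fin 4,
        (2 * (R : ℤ) + 4) ≤ |((((x i k - x j k : ℤ) : ZMod (2 * L + 1))).valMinAbs : ℤ)|) →
      |torusMoment r.ρ β L r.curvature.F (wilsonTorusMean r.ρ β L r.curvature.F) x| ≤ (C / (R : ℝ) ^ 4) ^ n :=
    fun n x hx => H β hβ₄ L n x R hR1 hRℓ hRL hx
  -- geometry of a contributing pair at an admissible scale
  have key : ∀ s : ℝ, u β / 2 ≤ s → s ≤ 2 * u β → ∀ x y : Site 4,
      thetaTest 4 v (s • siteToE x) * v (s • siteToE y) ≠ 0 →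
      ‖siteToE x‖ ≤ 2 * M / u β ∧ ‖siteToE y‖ ≤ 2 * M / u β ∧ δ / u β ≤ ‖x - y‖ := by
    intro s hslo hshi x y hne
    have hs : 0 < s := by linarith
    obtain ⟨h1, h2⟩ := mul_ne_zero_iff.1 hne
    rw [thetaTest_apply] at h1
    obtain ⟨hθt, hθn⟩ := hsupp _ h1
    obtain ⟨hyt, hyn⟩ := hsupp _ h2
    rw [LinearIsometryEquiv.norm_map] at hθn
    have hxt : s * (x 0 : ℝ) ≤ -δ := by
      have : δ ≤ -(s * (x 0 : ℝ)) := by simpa [timeReflection_apply, siteToE_apply] using hθt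
      linarith
    have hyt' : δ ≤ s * (y 0 : ℝ) := by simpa [siteToE_apply] using hyt
    have hMs : M / s ≤ 2 * M / u β := by
      rw [div_le_div_iff₀ hs huβ]
      have h' : M * u β ≤ M * (2 * s) := mul_le_mul_of_nonneg_left (by linarith) hM0.le
      linarith
    refine ⟨?_, ?_, ?_⟩
    · rw [norm_smul, Real.norm_of_nonneg hs.le] at hθn
      calc ‖siteToE x‖ ≤ M / s := by rw [le_div_iff₀ hs, mul_comm]; exact hθn
        _ ≤ 2 * M / u β := hMs
    · rw [norm_smul, Real.norm_of_nonneg hs.le] at hyn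
      calc ‖siteToE y‖ ≤ M / s := by rw [le_div_iff₀ hs, mul_comm]; exact hyn
        _ ≤ 2 * M / u β := hMs
    · have hds : δ / u β ≤ 2 * δ / s := by
        rw [div_le_div_iff₀ huβ hs]
        have h' : δ * s ≤ δ * (2 * u β) := mul_le_mul_of_nonneg_left hshi hδ.le
        linarith
      exact hds.trans (norm_sub_ge_of_time_sep hs x y hxt hyt')
  -- sup norm from the Euclidean norm of the position
  have hsup : ∀ x : Site 4, ‖x‖ ≤ ‖siteToE x‖ := fun x => by
    simpa using mul_norm_le_norm_smul_siteToE zero_le_one x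
  -- the box containing every contributing site
  set N : ℕ := ⌈2 * M / u β⌉₊ with hNdef
  have hNge : 2 * M / u β ≤ (N : ℝ) := Nat.le_ceil _
  have hNle : (N : ℝ) ≤ 2 * M / u β + 1 := (Nat.ceil_lt_add_one (by positivity)).le
  have hmemT : ∀ x : Site 4, ‖siteToE x‖ ≤ 2 * M / u β → x ∈ box 4 N := fun x hx =>
    mem_box_of_norm_le x ((hsup x).trans (hx.trans hNge))
  -- the two sums as weighted sums over `box × box`
  have hQ2 : ∀ s : ℝ, Q2 G r β L s (thetaTest 4 v) v = ∑ p ∈ box 4 L ×ˢ box 4 L,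
      (thetaTest 4 v (s • siteToE p.1) * v (s • siteToE p.2)) *
        (torusE G r β L (fun U => dens G r p.1 U * dens G r p.2 U) -
          torusE G r β L (dens G r p.1) * torusE G r β L (dens G r p.2)) := by
    intro s
    unfold Q2
    rw [Finset.sum_product]
  -- the perturbation estimate
  have hdiff : |Q2 G r β L (u β) (thetaTest 4 v) v - Q2 G r β L (a β) (thetaTest 4 v) v| ≤
      ((box 4 N ×ˢ box 4 N).card : ℝ) * ((2 * B * η) * (C ^ 2 * (2 * u β / ρ) ^ 8)) := by
    rw [hQ2 (u β), hQ2 (a β)]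
    refine abs_sum_mul_sub_sum_mul_le _ _ _ _ _ (by positivity) hw0 fun p _ hp => ?_
    -- geometry of the contributing pair
    have hgeo : ‖siteToE p.1‖ ≤ 2 * M / u β ∧ ‖siteToE p.2‖ ≤ 2 * M / u β ∧ δ / u β ≤ ‖p.1 - p.2‖ := by
      rcases hp with hp | hp
      · exact key (u β) (by linarith) (by linarith) p.1 p.2 hp
      · exact key (a β) halo hahi p.1 p.2 hp
    obtain ⟨hx, hy, hxy⟩ := hgeo
    refine ⟨Finset.mem_product.2 ⟨hmemT p.1 hx, hmemT p.2 hy⟩, ?_, ?_⟩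
    · -- the collar ceiling on the separated pair
      have h4M : 4 * M / u β ≤ (L : ℝ) := by rw [div_le_iff₀ huβ]; linarith [hL2]
      have hxL : 2 * ‖p.1‖ ≤ (L : ℝ) := by
        calc 2 * ‖p.1‖ ≤ 2 * (2 * M / u β) := by linarith [hsup p.1, hx]
          _ = 4 * M / u β := by ring
          _ ≤ L := h4M
      have hyL : 2 * ‖p.2‖ ≤ (L : ℝ) := by
        calc 2 * ‖p.2‖ ≤ 2 * (2 * M / u β) := by linarith [hsup p.2, hy]
          _ = 4 * M / u β := by ring
          _ ≤ L := h4M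
      exact (abs_cov_le r Hβ p.1 p.2 hxL hyL (hsepR.trans hxy)).trans hw
    · -- the weight difference, by uniform continuity of the bump
      have hua : |u β - a β| = u β * |1 - a β / u β| := by
        have h' : u β - a β = u β * (1 - a β / u β) := by field_simp
        rw [h', abs_mul, abs_of_pos huβ]
      have hclose : ∀ X : EuclideanSpace ℝ (Fin 4), ‖X‖ ≤ 2 * M / u β → ‖u β • X - a β • X‖ < θ₀ := by
        intro X hX
        rw [← sub_smul, norm_smul, Real.norm_eq_abs, hua]
        calc u β * |1 - a β / u β| * ‖X‖ ≤ u β * |1 - a β / u β| * (2 * M / u β) :=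
              mul_le_mul_of_nonneg_left hX (by positivity)
          _ = 2 * M * |1 - a β / u β| := by field_simp
          _ < θ₀ := hθ
      have d1 : |v (timeReflection 4 (u β • siteToE p.1)) - v (timeReflection 4 (a β • siteToE p.1))| < η := by
        refine hmod _ _ ?_
        rw [← map_sub, LinearIsometryEquiv.norm_map]
        exact hclose _ hx
      have d2 : |v (u β • siteToE p.2) - v (a β • siteToE p.2)| < η := hmod _ _ (hclose _ hy)
      simp only [thetaTest_apply]
      have hid : v (timeReflection 4 (u β • siteToE p.1)) * v (u β • siteToE p.2) -
            v (timeReflection 4 (a β • siteToE p.1)) * v (a β • siteToE p.2) =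
          (v (timeReflection 4 (u β • siteToE p.1)) - v (timeReflection 4 (a β • siteToE p.1))) *
              v (u β • siteToE p.2) +
            v (timeReflection 4 (a β • siteToE p.1)) * (v (u β • siteToE p.2) - v (a β • siteToE p.2)) := by
        ring
      rw [hid]
      refine (abs_add_le _ _).trans ?_
      rw [abs_mul, abs_mul]
      calc |v (timeReflection 4 (u β • siteToE p.1)) - v (timeReflection 4 (a β • siteToE p.1))| *
              |v (u β • siteToE p.2)| +
            |v (timeReflection 4 (a β • siteToE p.1))| * |v (u β • siteToE p.2) - v (a β • siteToE p.2)|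
          ≤ η * B + B * η :=
            add_le_add (mul_le_mul d1.le (hBv _) (abs_nonneg _) hη0.le)
              (mul_le_mul (hBv _) d2.le (abs_nonneg _) hB0)
        _ = 2 * B * η := by ring
  -- count the box and conclude
  obtain ⟨t, ht⟩ : ∃ t : ℝ, t = ((2 * N + 1 : ℕ) : ℝ) := ⟨_, rfl⟩
  have hcard : ((box 4 N ×ˢ box 4 N).card : ℝ) = t ^ 8 := by
    rw [Finset.card_product, card_box, ht]; push_cast; ring
  have ht0 : 0 ≤ t := by rw [ht]; positivity
  have ht7 : t ≤ 7 * M / u β := by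
    rw [ht]
    push_cast
    have h3 : (3 : ℝ) ≤ 3 * M / u β := by
      rw [le_div_iff₀ huβ]; linarith only [hM, hu1]
    calc 2 * (N : ℝ) + 1 ≤ 2 * (2 * M / u β + 1) + 1 := by linarith only [hNle]
      _ = 4 * M / u β + 3 := by ring
      _ ≤ 4 * M / u β + 3 * M / u β := by linarith only [h3]
      _ = 7 * M / u β := by ring
  clear_value N
  have h14 : (7 * M / u β) * (2 * u β / ρ) = 14 * M / ρ := by
    field_simp
    ring
  have hX0 : 0 ≤ (2 * B * η) * (C ^ 2 * (2 * u β / ρ) ^ 8) := by positivity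
  have hbound : (t ^ 8) * ((2 * B * η) * (C ^ 2 * (2 * u β / ρ) ^ 8)) ≤ K₀ * η := by
    have h8 : t ^ 8 ≤ (7 * M / u β) ^ 8 := pow_le_pow_left₀ ht0 ht7 8
    calc t ^ 8 * ((2 * B * η) * (C ^ 2 * (2 * u β / ρ) ^ 8))
        ≤ (7 * M / u β) ^ 8 * ((2 * B * η) * (C ^ 2 * (2 * u β / ρ) ^ 8)) :=
          mul_le_mul_of_nonneg_right h8 hX0
      _ = ((7 * M / u β) * (2 * u β / ρ)) ^ 8 * (2 * B * C ^ 2) * η := by ring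
      _ = (14 * M / ρ) ^ 8 * (2 * B * C ^ 2) * η := by rw [h14]
      _ = K₀ * η := by rw [hK₀]
  rw [hcard] at hdiff
  have hfin := abs_sub_le_iff.1 (hdiff.trans (hbound.trans hKη))
  linarith [hfin.2, hfl]

end Summit.QuantumFields.YangMills.Cruxes.UVSeamRec.UnitTransfer

end
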